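import Summits.RiemannHypothesis.RiemannHypothesis.Theorems.WeilFormatCCinfImageGlue
import HarnessLib

/-!
# Format C, design C∞ (E3, analytic side): the BLOCK entries of the DoorB certificates — cross and profile×profile

Route context: Fourier–Galerkin / Schur-complement certificates of Weil positivity on a window ("format C", C∞ door;
cell memo `run/shared/lean/pub/rh-explicit/rh-explicit-weil-10/KERNEL-LEVER.md` §21; supporting stmt-RiemannHypothesis-0098;
seat rh-explicit-weil-10).  The margin hypothesis `hS` of `weilPositivityOn_of_formatC_cinfB(A)` is a quadratic form in
`(x, β)` whose entries are the sector kernel block `M^±(i,i')` (format-C column boxes), the CROSS entries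
`Re W(φ_j − proj_B φ_j, w⁺_i)/d_i` (`i ≤ B`) resp. `Im W(φ_j − proj_B φ_j, w⁻_{i+1})/√2`, and the PROFILE×PROFILE entries
`Re W(φ_j − proj_B φ_j, φ_{j'} − proj_B φ_{j'})` (weil-2 CINF-GENERATOR-SPEC B4–B6).  `WeilFormatCCinfImageGlue`
removed the projection for far modes (`B < m`); here the same is done for ALL modes and for the profile×profile entries,
so every block entry is a finite combination of: full images `Re W(φ, w⁺_n)/d_n` / `Im W(φ, w⁻_{n+1})/√2` at low modes
(gen8 mixed boxes), the kernel block, the low profile tables `V_φ(n)`, and `Re W(φ, ψ)` (gen8 entry boxes):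

* `re_weilWindowSesq_proj_chiEven_div_all`, `re_weilWindowSesq_sub_proj_chiEven_div_all` — the even cross entries,
  any mode `m` (normaliser `d_m = 1, √2`);
* `re_weilWindowSesq_band_band_even` —
  `Re W(φ − Pφ, ψ − Pψ) = Re W(φ,ψ) − Σ_n V_ψ(n)·Re W(φ,w⁺_n)/d_n − Σ_n V_φ(n)·Re W(ψ,w⁺_n)/d_n + Σ_n Σ_{n'} V_φ(n)M⁺(n,n')V_ψ(n')`;
* `re_weilWindowSesq_band_band_odd` — the odd twin with `V⁻(k) = 2 Im ĉ_{k+1}/√(2a)`, `Im W(·, w⁻_{k+1})/√2`, `M⁻`;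
* `re_weilWindowSesq_indicator_poly_chi_zero` — the mode-`0` image of a real polynomial profile.

Pure algebra over the landed sector identities; standard axioms; no definitions; no RH claim.
-/

set_option autoImplicit false
-- `Summit.RiemannHypothesis.RiemannHypothesis.…` is the layout-mandated namespace (summit = problem name).
set_option linter.dupNamespace false

noncomputable section

open Complex Filter Set MeasureTheory
open scoped Real Topology ComplexConjugate

namespace Summit.RiemannHypothesis.RiemannHypothesis.Theorems.WeilFormatC

open Literature.NumberTheory.LFunctions Literature.NumberTheory.LFunctions.Yoshida1992

variable {a : ℝ}

/-! ## Even cross entries, any mode -/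

/-- **`W_a(proj_B φ, w⁺_m)` on the even basis, any mode `m`** (`a > 0`, `φ` even real):
`Re W_a(proj_B φ, w⁺_m)/d_m = Σ_{n∈[0,B]} M⁺(n,m)·V⁺_φ(n)`. -/
theorem re_weilWindowSesq_proj_chiEven_div_all (ha : 0 < a) {φ : ℝ → ℂ} (hφ : ∀ x, φ (-x) = φ x)
    (hφr : ∀ x, conj (φ x) = φ x) (B m : ℕ) :
    (weilWindowSesq a (proj a B φ) (chiEven a m)).re / (if m = 0 then 1 else Real.sqrt 2)
      = ∑ n ∈ Finset.range (B + 1),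
          (if n = 0 then gramCoeff a 0 m else if m = 0 then gramCoeff a n 0
            else (gramCoeff a n m + gramCoeff a n (-(m : ℤ))) / 2) *
          ((if n = 0 then 1 else 2) * (Yoshida1992.fourierCoeff a n φ).re / Real.sqrt (2 * a)) := by
  have hdm : (0 : ℝ) < (if m = 0 then 1 else Real.sqrt 2) := by
    split_ifs
    · norm_num
    · exact Real.sqrt_pos.2 (by norm_num)
  have hs2 : Real.sqrt 2 * Real.sqrt 2 = 2 := Real.mul_self_sqrt (by norm_num)
  rw [div_eq_iff hdm.ne', proj_eq_sum_chiEven hφ a B,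
    weilWindowSesq_sum_left ha.le _ (fun i _ ↦ isWindowFunction_chiEven ha i) (isWindowFunction_chiEven ha m) _ a]
  simp_rw [zeta_eq_ofReal hφ hφr, weilWindowSesq_chiEven_chiEven ha, ← Complex.ofReal_mul]
  rw [← Complex.ofReal_sum, Complex.ofReal_re, Finset.sum_mul]
  refine Finset.sum_congr rfl fun n _ ↦ ?_
  by_cases hn : n = 0
  · subst hn
    simp only [if_true, Nat.cast_zero]
    ring
  · simp only [if_neg hn]
    split_ifs with hm
    · linear_combination (gramCoeff a n 0 * (Yoshida1992.fourierCoeff a n φ).re / Real.sqrt (2 * a)) * hs2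
    · linear_combination ((gramCoeff a n m + gramCoeff a n (-(m : ℤ))) / 2 *
        (Yoshida1992.fourierCoeff a n φ).re * Real.sqrt 2 / Real.sqrt (2 * a)) * hs2

/-- **Removing the projection, even sector, any mode** (`a > 0`, `φ` an even real window function):
`Re W_a(φ − proj_B φ, w⁺_m)/d_m = Re W_a(φ, w⁺_m)/d_m − Σ_{n∈[0,B]} M⁺(n,m)·V⁺_φ(n)` — the cross entries of `hS`
(`m ≤ B`) as well as the far images (`m > B`). -/
theorem re_weilWindowSesq_sub_proj_chiEven_div_all (ha : 0 < a) {φ : ℝ → ℂ} (hφ : ∀ x, φ (-x) = φ x)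
    (hφr : ∀ x, conj (φ x) = φ x) (hφw : IsWindowFunction a φ) (B m : ℕ) :
    (weilWindowSesq a (φ - proj a B φ) (chiEven a m)).re / (if m = 0 then 1 else Real.sqrt 2)
      = (weilWindowSesq a φ (chiEven a m)).re / (if m = 0 then 1 else Real.sqrt 2)
        - ∑ n ∈ Finset.range (B + 1),
            (if n = 0 then gramCoeff a 0 m else if m = 0 then gramCoeff a n 0
              else (gramCoeff a n m + gramCoeff a n (-(m : ℤ))) / 2) *
            ((if n = 0 then 1 else 2) * (Yoshida1992.fourierCoeff a n φ).re / Real.sqrt (2 * a)) := by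
  rw [weilWindowSesq_sub_left ha.le hφw (isWindowFunction_proj ha B φ) (isWindowFunction_chiEven ha m),
    Complex.sub_re, sub_div, re_weilWindowSesq_proj_chiEven_div_all ha hφ hφr B m]

/-- **An even window against a projection**: `Re W_a(u, proj_B ψ) = Σ_{n∈[0,B]} V⁺_ψ(n)·Re W_a(u, w⁺_n)/d_n`
(`ψ` even real, `u` any window function). -/
theorem re_weilWindowSesq_proj_right_even (ha : 0 < a) {u ψ : ℝ → ℂ} (hu : IsWindowFunction a u)
    (hψ : ∀ x, ψ (-x) = ψ x) (hψr : ∀ x, conj (ψ x) = ψ x) (B : ℕ) :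
    (weilWindowSesq a u (proj a B ψ)).re
      = ∑ n ∈ Finset.range (B + 1),
          ((if n = 0 then 1 else 2) * (Yoshida1992.fourierCoeff a n ψ).re / Real.sqrt (2 * a)) *
          ((weilWindowSesq a u (chiEven a n)).re / (if n = 0 then 1 else Real.sqrt 2)) := by
  have hs2 : Real.sqrt 2 * Real.sqrt 2 = 2 := Real.mul_self_sqrt (by norm_num)
  have hs0 : Real.sqrt 2 ≠ 0 := (Real.sqrt_pos.2 (by norm_num : (0:ℝ) < 2)).ne'
  rw [proj_eq_sum_chiEven hψ a B,
    weilWindowSesq_sum_right ha.le _ (fun i _ ↦ isWindowFunction_chiEven ha i) hu _ a, Complex.re_sum]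
  refine Finset.sum_congr rfl fun n _ ↦ ?_
  rw [zeta_eq_ofReal hψ hψr, Complex.conj_ofReal, Complex.re_ofReal_mul]
  by_cases hn : n = 0
  · subst hn; simp only [if_true]; ring
  · simp only [if_neg hn]
    field_simp
    rw [Real.sq_sqrt (by norm_num : (0 : ℝ) ≤ 2)]
    ring

/-- **The even profile×profile entries of `hS`** (`a > 0`, `φ, ψ` even real window functions, any `B`):
`Re W(φ − proj_B φ, ψ − proj_B ψ) = Re W(φ,ψ) − Σ_n V_ψ(n)·Re W(φ,w⁺_n)/d_n − Σ_n V_φ(n)·Re W(ψ,w⁺_n)/d_n`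
`  + Σ_n V_ψ(n) Σ_{n'} M⁺(n',n) V_φ(n')` (`n, n' ∈ [0,B]`). -/
theorem re_weilWindowSesq_band_band_even (ha : 0 < a) {φ ψ : ℝ → ℂ} (hφ : ∀ x, φ (-x) = φ x)
    (hφr : ∀ x, conj (φ x) = φ x) (hφw : IsWindowFunction a φ) (hψ : ∀ x, ψ (-x) = ψ x)
    (hψr : ∀ x, conj (ψ x) = ψ x) (hψw : IsWindowFunction a ψ) (B : ℕ) :
    (weilWindowSesq a (φ - proj a B φ) (ψ - proj a B ψ)).re
      = (weilWindowSesq a φ ψ).re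
        - ∑ n ∈ Finset.range (B + 1),
            ((if n = 0 then 1 else 2) * (Yoshida1992.fourierCoeff a n ψ).re / Real.sqrt (2 * a)) *
            ((weilWindowSesq a φ (chiEven a n)).re / (if n = 0 then 1 else Real.sqrt 2))
        - ∑ n ∈ Finset.range (B + 1),
            ((if n = 0 then 1 else 2) * (Yoshida1992.fourierCoeff a n φ).re / Real.sqrt (2 * a)) *
            ((weilWindowSesq a ψ (chiEven a n)).re / (if n = 0 then 1 else Real.sqrt 2))
        + ∑ n ∈ Finset.range (B + 1),
            ((if n = 0 then 1 else 2) * (Yoshida1992.fourierCoeff a n ψ).re / Real.sqrt (2 * a)) *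
            ∑ n' ∈ Finset.range (B + 1),
              (if n' = 0 then gramCoeff a 0 n else if n = 0 then gramCoeff a n' 0
                else (gramCoeff a n' n + gramCoeff a n' (-(n : ℤ))) / 2) *
              ((if n' = 0 then 1 else 2) * (Yoshida1992.fourierCoeff a n' φ).re / Real.sqrt (2 * a)) := by
  have hPφ := isWindowFunction_proj ha B φ
  have hPψ := isWindowFunction_proj ha B ψ
  rw [weilWindowSesq_sub_left ha.le hφw hPφ (hψw.sub hPψ),
    weilWindowSesq_sub_right ha.le hφw hψw hPψ, weilWindowSesq_sub_right ha.le hPφ hψw hPψ,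
    Complex.sub_re, Complex.sub_re, Complex.sub_re,
    re_weilWindowSesq_proj_right_even ha hφw hψ hψr B, re_weilWindowSesq_proj_right_even ha hPφ hψ hψr B]
  -- `Re W(Pφ, ψ) = Re W(ψ, Pφ)`
  have hsym : (weilWindowSesq a (proj a B φ) ψ).re = (weilWindowSesq a ψ (proj a B φ)).re := by
    rw [weilWindowSesq_conj_symm a ψ (proj a B φ), Complex.conj_re]
  rw [hsym, re_weilWindowSesq_proj_right_even ha hψw hφ hφr B]
  simp_rw [re_weilWindowSesq_proj_chiEven_div_all ha hφ hφr B]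
  ring

/-! ## Odd profile×profile entries -/

/-- **A window against an odd projection**: `Re W_a(u, proj_B ψ) = Σ_{k∈[0,B)} V⁻_ψ(k)·Im W_a(u, w⁻_{k+1})/√2`
(`ψ` odd real, `u` any window function; `V⁻_ψ(k) = 2 Im ĉ_{k+1}(ψ)/√(2a)`). -/
theorem re_weilWindowSesq_proj_right_odd (ha : 0 < a) {u ψ : ℝ → ℂ} (hu : IsWindowFunction a u)
    (hψ : ∀ x, ψ (-x) = -ψ x) (hψr : ∀ x, conj (ψ x) = ψ x) (B : ℕ) :
    (weilWindowSesq a u (proj a B ψ)).re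
      = ∑ k ∈ Finset.Ico 0 B,
          (2 * (Yoshida1992.fourierCoeff a ((k : ℤ) + 1) ψ).im / Real.sqrt (2 * a)) *
          ((weilWindowSesq a u (chiOdd a (k + 1))).im / Real.sqrt 2) := by
  have hs0 : Real.sqrt 2 ≠ 0 := (Real.sqrt_pos.2 (by norm_num : (0:ℝ) < 2)).ne'
  have hP : proj a B ψ = proj a B ψ - proj a 0 ψ := by rw [proj_zero_eq_zero_of_odd a hψ, sub_zero]
  rw [hP, band_eq_sum_chiOdd hψ a (Nat.zero_le B),
    weilWindowSesq_sum_right ha.le _ (fun k _ ↦ isWindowFunction_chiOdd ha (k + 1)) hu _ a, Complex.re_sum]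
  refine Finset.sum_congr rfl fun k _ ↦ ?_
  rw [zetaOdd_eq hψ hψr, map_mul, Complex.conj_ofReal, Complex.conj_I]
  have e : ((((Real.sqrt 2 * (Yoshida1992.fourierCoeff a ((k : ℤ) + 1) ψ).im / Real.sqrt (2 * a)) : ℝ) : ℂ) * -I
      * weilWindowSesq a u (chiOdd a (k + 1))).re
      = Real.sqrt 2 * (Yoshida1992.fourierCoeff a ((k : ℤ) + 1) ψ).im / Real.sqrt (2 * a)
        * (weilWindowSesq a u (chiOdd a (k + 1))).im := by
    rw [mul_assoc, Complex.re_ofReal_mul]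
    simp only [Complex.mul_re, Complex.neg_re, Complex.neg_im, Complex.I_re, Complex.I_im, neg_zero, zero_mul,
      zero_sub]
    ring
  rw [e]
  field_simp
  rw [Real.sq_sqrt (by norm_num : (0 : ℝ) ≤ 2)]
  ring

/-- **The odd profile×profile entries of `hS`** (`a > 0`, `φ, ψ` odd real window functions, any `B`):
`Re W(φ − proj_B φ, ψ − proj_B ψ) = Re W(φ,ψ) − Σ_k V⁻_ψ(k)·Im W(φ,w⁻_{k+1})/√2 − Σ_k V⁻_φ(k)·Im W(ψ,w⁻_{k+1})/√2`
`  + Σ_k V⁻_ψ(k) Σ_{k'} M⁻(k',k) V⁻_φ(k')` (`k, k' ∈ [0,B)`). -/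
theorem re_weilWindowSesq_band_band_odd (ha : 0 < a) {φ ψ : ℝ → ℂ} (hφ : ∀ x, φ (-x) = -φ x)
    (hφr : ∀ x, conj (φ x) = φ x) (hφw : IsWindowFunction a φ) (hψ : ∀ x, ψ (-x) = -ψ x)
    (hψr : ∀ x, conj (ψ x) = ψ x) (hψw : IsWindowFunction a ψ) (B : ℕ) :
    (weilWindowSesq a (φ - proj a B φ) (ψ - proj a B ψ)).re
      = (weilWindowSesq a φ ψ).re
        - ∑ k ∈ Finset.Ico 0 B,
            (2 * (Yoshida1992.fourierCoeff a ((k : ℤ) + 1) ψ).im / Real.sqrt (2 * a)) *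
            ((weilWindowSesq a φ (chiOdd a (k + 1))).im / Real.sqrt 2)
        - ∑ k ∈ Finset.Ico 0 B,
            (2 * (Yoshida1992.fourierCoeff a ((k : ℤ) + 1) φ).im / Real.sqrt (2 * a)) *
            ((weilWindowSesq a ψ (chiOdd a (k + 1))).im / Real.sqrt 2)
        + ∑ k ∈ Finset.Ico 0 B,
            (2 * (Yoshida1992.fourierCoeff a ((k : ℤ) + 1) ψ).im / Real.sqrt (2 * a)) *
            ∑ k' ∈ Finset.Ico 0 B,
              ((gramCoeff a ((k' : ℤ) + 1) ((k : ℤ) + 1) - gramCoeff a ((k' : ℤ) + 1) (-((k : ℤ) + 1))) / 2) *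
              (2 * (Yoshida1992.fourierCoeff a ((k' : ℤ) + 1) φ).im / Real.sqrt (2 * a)) := by
  have hPφ := isWindowFunction_proj ha B φ
  have hPψ := isWindowFunction_proj ha B ψ
  rw [weilWindowSesq_sub_left ha.le hφw hPφ (hψw.sub hPψ),
    weilWindowSesq_sub_right ha.le hφw hψw hPψ, weilWindowSesq_sub_right ha.le hPφ hψw hPψ,
    Complex.sub_re, Complex.sub_re, Complex.sub_re,
    re_weilWindowSesq_proj_right_odd ha hφw hψ hψr B, re_weilWindowSesq_proj_right_odd ha hPφ hψ hψr B]
  have hsym : (weilWindowSesq a (proj a B φ) ψ).re = (weilWindowSesq a ψ (proj a B φ)).re := by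
    rw [weilWindowSesq_conj_symm a ψ (proj a B φ), Complex.conj_re]
  rw [hsym, re_weilWindowSesq_proj_right_odd ha hψw hφ hφr B]
  have hrow : ∀ k : ℕ, (weilWindowSesq a (proj a B φ) (chiOdd a (k + 1))).im / Real.sqrt 2
      = ∑ k' ∈ Finset.Ico 0 B,
          ((gramCoeff a ((k' : ℤ) + 1) ((k : ℤ) + 1) - gramCoeff a ((k' : ℤ) + 1) (-((k : ℤ) + 1))) / 2) *
          (2 * (Yoshida1992.fourierCoeff a ((k' : ℤ) + 1) φ).im / Real.sqrt (2 * a)) := by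
    intro k
    have hP : proj a B φ = proj a B φ - proj a 0 φ := by rw [proj_zero_eq_zero_of_odd a hφ, sub_zero]
    rw [hP]
    exact (sum_Ico_oddKernel_mul_eq ha hφ hφr (Nat.zero_le B) k).symm
  simp_rw [hrow]
  ring

/-! ## The mode-`0` image of a polynomial profile -/

/-- **Mode `0`**: `Re W_a(1·Σ_q c_q x^q, w⁺_0) = Σ_q c_q Re W_a(1x^q, χ_0)` (`w⁺_0 = χ_0`, normaliser `d_0 = 1`). -/
theorem re_weilWindowSesq_indicator_poly_chiEven_zero (ha : 0 < a) (s : Finset ℕ) (c : ℕ → ℝ) :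
    (weilWindowSesq a ((Icc (-a) a).indicator fun x : ℝ ↦ ∑ q ∈ s, ((c q : ℝ) : ℂ) * ((x : ℂ)) ^ q)
        (chiEven a 0)).re
      = ∑ q ∈ s, c q * (weilWindowSesq a ((Icc (-a) a).indicator fun x : ℝ ↦ ((x : ℂ)) ^ q) (chi a 0)).re := by
  have h0 : chiEven a 0 = chi a 0 := by unfold chiEven; rw [if_pos rfl]
  rw [h0, indicator_sum_mul_pow, weilWindowSesq_sum_left ha.le _ (fun q _ ↦ isWindowFunction_indicator_pow a q)
    (isWindowFunction_chi ha 0) _ a, Complex.re_sum]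
  exact Finset.sum_congr rfl fun q _ ↦ Complex.re_ofReal_mul _ _

end Summit.RiemannHypothesis.RiemannHypothesis.Theorems.WeilFormatC
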